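import Mathlib
import Summits.ResolutionOfSingularities.ResolutionOfSingularities.Theorems.ShadowGameWinR.Negative.MirrorR
import Summits.ResolutionOfSingularities.ResolutionOfSingularities.Theorems.ShadowGameShadowGameWinRStubDictionary
import Summits.ResolutionOfSingularities.ResolutionOfSingularities.Theorems.ShadowGameShadowGameWinRStubClosure
import Summits.ResolutionOfSingularities.ResolutionOfSingularities.Theorems.ShadowGameShadowGameWinRStubOrders

/-!
# `ShadowGameWinR` (crux stmt-ResolutionOfSingularities-18182, route `ShadowGame`), negative side —
# part 4: the invariant of B's play

Against EVERY strategy of A (non-empty centres), B's simulated play `runR` from `c0R = x · Π₀^p`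
stays inside the position family: `(runR m).1 = fn (posSt p a e b U E)` with `U, E` units
(`runR_fst_posSt`).  One move (`step_posSt`): for each of the seven non-empty centres `F`, B's
answer `(chartR F, tauR)` is, by the dictionary `stub_dictionary`, the substitution `substMap F
(chartR F) tauR` followed by the division by `u_i^s`, `s = p ⌊m_F/p⌋` (`stub_orders` gives
`m_F = [x ∈ F] + p·m`), followed by cleaning (the identity on positions); `stub_closure` computes the
substituted position as `u_i^{p m}` times a new position.
Lead prover-line-stmt-ResolutionOfSingularities-18182-0, 2026-08-17.
-/

noncomputable section

set_option linter.dupNamespace false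

namespace Summit.ResolutionOfSingularities.ResolutionOfSingularities.Theorems.ShadowGameWinR.Negative

open Summit.ResolutionOfSingularities.ResolutionOfSingularities.Theorems.ShadowGameWin.Negative
  (clean mF step shadow)
open MvPowerSeries

section Assembly

variable (p : ℕ) [hp : Fact p.Prime] (κ : Type) [Field κ] [CharP κ p]

/-- The eight subsets of `Fin 3`. [folklore] -/
theorem finset_fin_three_cases (F : Finset (Fin 3)) :
    F = ∅ ∨ F = {0} ∨ F = {1} ∨ F = {2} ∨ F = {0, 1} ∨ F = {0, 2} ∨ F = {1, 2} ∨ F = Finset.univ := by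
  by_cases h0 : (0 : Fin 3) ∈ F <;> by_cases h1 : (1 : Fin 3) ∈ F <;> by_cases h2 : (2 : Fin 3) ∈ F
  · right; right; right; right; right; right; right; ext j; fin_cases j <;> simp [h0, h1, h2]
  · right; right; right; right; left; ext j; fin_cases j <;> simp [h0, h1, h2]
  · right; right; right; right; right; left; ext j; fin_cases j <;> simp [h0, h1, h2]
  · right; left; ext j; fin_cases j <;> simp [h0, h1, h2]
  · right; right; right; right; right; right; left; ext j; fin_cases j <;> simp [h0, h1, h2]
  · right; right; left; ext j; fin_cases j <;> simp [h0, h1, h2]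
  · right; right; right; left; ext j; fin_cases j <;> simp [h0, h1, h2]
  · left; ext j; fin_cases j <;> simp [h0, h1, h2]

/-- `stub_orders`, spelled with `fn` and `posSt`. [folklore] -/
theorem orders_posSt (a e b : ℕ) (U E : MvPowerSeries (Fin 3) κ) (hU : IsUnit U) (hE : IsUnit E) :
    mF Finset.univ (fn (posSt p a e b U E)) = 1 + p * min (a + 2 * e + 2) (b + 3) ∧
    mF {0, 2} (fn (posSt p a e b U E)) = 1 + p * min (a + 2 * e) (b + 3) ∧
    mF {0, 1} (fn (posSt p a e b U E)) = 1 + p * min (a + 2) b ∧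
    mF {1, 2} (fn (posSt p a e b U E)) = 0 ∧
    mF {0} (fn (posSt p a e b U E)) = 1 + p * min a b ∧
    mF {1} (fn (posSt p a e b U E)) = 0 ∧
    mF {2} (fn (posSt p a e b U E)) = 0 ∧
    (∀ d : Fin 3 →₀ ℕ, (∀ j, p ∣ d j) → MvPowerSeries.coeff d (posSt p a e b U E) = 0) ∧
    posSt p a e b U E ≠ 0 ∧
    (∀ d : Fin 3 →₀ ℕ, Finsupp.degree d ≤ 1 → MvPowerSeries.coeff d (posSt p a e b U E) = 0) :=
  stub_orders p κ a e b U E hU hE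

/-- B's substitution for the point centre is `![x, xy, x(z+1)]`. [folklore] -/
theorem substMap_univ :
    substMap Finset.univ 0 (tauR κ) = (![X 0, X 0 * X 1, X 0 * (X 2 + 1)] : Fin 3 → MvPowerSeries (Fin 3) κ) := by
  funext j; fin_cases j <;> simp [substMap, tauR]

/-- B's substitution for the centre `{x,z}` is `![x, y, x(z+1)]`. [folklore] -/
theorem substMap_02 :
    substMap {0, 2} 0 (tauR κ) = (![X 0, X 1, X 0 * (X 2 + 1)] : Fin 3 → MvPowerSeries (Fin 3) κ) := by
  funext j; fin_cases j <;> simp [substMap, tauR]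

/-- B's substitution for the centre `{x,y}` is `![x, xy, z]`. [folklore] -/
theorem substMap_01 :
    substMap {0, 1} 0 (tauR κ) = (![X 0, X 0 * X 1, X 2] : Fin 3 → MvPowerSeries (Fin 3) κ) := by
  funext j; fin_cases j <;> simp [substMap, tauR]

/-- B's substitution for the centre `{y,z}` (chart `z`) is `![x, zy, z]`. [folklore] -/
theorem substMap_12 :
    substMap {1, 2} 2 (tauR κ) = (![X 0, X 2 * X 1, X 2] : Fin 3 → MvPowerSeries (Fin 3) κ) := by
  funext j; fin_cases j <;> simp [substMap, tauR]

/-- B's substitution for a singleton centre is the identity. [folklore] -/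
theorem substMap_single (j : Fin 3) : substMap {j} j (tauR κ) = X := by
  funext l
  by_cases h : l = j
  · subst h; simp [substMap]
  · simp [substMap, h]

/-- `stub_closure`, spelled with `posSt` and `substMap`. [folklore] -/
theorem closure_posSt (a e b : ℕ) (U E : MvPowerSeries (Fin 3) κ) (hU : IsUnit U) (hE : IsUnit E) :
    (MvPowerSeries.subst (substMap Finset.univ 0 (tauR κ)) (posSt p a e b U E) =
       X 0 ^ (p * min (a + 2 * e + 2) (b + 3)) *
         posSt p (a + 2 * e + 2 - min (a + 2 * e + 2) (b + 3)) 0 (b + 3 - min (a + 2 * e + 2) (b + 3))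
           ((X 2 + 1) ^ (2 * e) * MvPowerSeries.subst (substMap Finset.univ 0 (tauR κ)) U)
           (MvPowerSeries.subst (substMap Finset.univ 0 (tauR κ)) E)
     ∧ IsUnit ((X 2 + 1) ^ (2 * e) * MvPowerSeries.subst (substMap Finset.univ 0 (tauR κ)) U)
     ∧ IsUnit (MvPowerSeries.subst (substMap Finset.univ 0 (tauR κ)) E)) ∧
    (MvPowerSeries.subst (substMap {0, 2} 0 (tauR κ)) (posSt p a e b U E) =
       X 0 ^ (p * min (a + 2 * e) (b + 3)) *
         posSt p (a + 2 * e - min (a + 2 * e) (b + 3)) 0 (b + 3 - min (a + 2 * e) (b + 3))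
           ((X 2 + 1) ^ (2 * e) * MvPowerSeries.subst (substMap {0, 2} 0 (tauR κ)) U)
           (MvPowerSeries.subst (substMap {0, 2} 0 (tauR κ)) E)
     ∧ IsUnit ((X 2 + 1) ^ (2 * e) * MvPowerSeries.subst (substMap {0, 2} 0 (tauR κ)) U)
     ∧ IsUnit (MvPowerSeries.subst (substMap {0, 2} 0 (tauR κ)) E)) ∧
    (MvPowerSeries.subst (substMap {0, 1} 0 (tauR κ)) (posSt p a e b U E) =
       X 0 ^ (p * min (a + 2) b) * posSt p (a + 2 - min (a + 2) b) e (b - min (a + 2) b)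
         (MvPowerSeries.subst (substMap {0, 1} 0 (tauR κ)) U) (MvPowerSeries.subst (substMap {0, 1} 0 (tauR κ)) E)
     ∧ IsUnit (MvPowerSeries.subst (substMap {0, 1} 0 (tauR κ)) U)
     ∧ IsUnit (MvPowerSeries.subst (substMap {0, 1} 0 (tauR κ)) E)) ∧
    (MvPowerSeries.subst (substMap {1, 2} 2 (tauR κ)) (posSt p a e b U E) =
       posSt p a (e + 1) b (MvPowerSeries.subst (substMap {1, 2} 2 (tauR κ)) U)
         (MvPowerSeries.subst (substMap {1, 2} 2 (tauR κ)) E)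
     ∧ IsUnit (MvPowerSeries.subst (substMap {1, 2} 2 (tauR κ)) U)
     ∧ IsUnit (MvPowerSeries.subst (substMap {1, 2} 2 (tauR κ)) E)) ∧
    (posSt p a e b U E = X 0 ^ (p * min a b) * posSt p (a - min a b) e (b - min a b) U E) := by
  have h := stub_closure p κ a e b U E hU hE
  simp only [] at h
  rw [substMap_univ, substMap_02, substMap_01, substMap_12]
  exact h

/-- Cleaning is the identity on positions. [folklore] -/
theorem clean_fn_posSt (a e b : ℕ) (U E : MvPowerSeries (Fin 3) κ) (hU : IsUnit U) (hE : IsUnit E) :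
    clean p (fn (posSt p a e b U E)) = fn (posSt p a e b U E) := by
  obtain ⟨-, -, -, -, -, -, -, hcl, -, -⟩ := orders_posSt p κ a e b U E hU hE
  funext A
  unfold clean
  split_ifs with h
  · exact (hcl (Finsupp.equivFunOnFinite.symm A) (fun j => by simpa using h j)).symm
  · rfl

/-- One move, given the factorisation: `step = fn g` when `f(a) = u_i^s g` with `g` a position.
[folklore] -/
theorem step_eq_of_fac (F : Finset (Fin 3)) (i : Fin 3) (hi : i ∈ F) (a e b a' e' b' : ℕ)
    (U E U' E' : MvPowerSeries (Fin 3) κ) (hU : IsUnit U) (hE : IsUnit E) (hU' : IsUnit U')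
    (hE' : IsUnit E') (s : ℕ) (hs : s = p * (mF F (fn (posSt p a e b U E)) / p))
    (hfac : MvPowerSeries.subst (substMap F i (tauR κ)) (posSt p a e b U E) = X i ^ s * posSt p a' e' b' U' E') :
    step p F i (tauR κ) (fn (posSt p a e b U E)) = fn (posSt p a' e' b' U' E') := by
  obtain ⟨-, -, -, -, -, -, -, hcl, -, -⟩ := orders_posSt p κ a e b U E hU hE
  have h := stub_dictionary p κ F i hi (tauR κ) (posSt p a e b U E) (posSt p a' e' b' U' E') hcl s hs hfac
  rw [← clean_fn_posSt p κ a' e' b' U' E' hU' hE']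
  exact h

/-- `s = p · ⌊m_F / p⌋` for `m_F = 1 + p m`. [folklore] -/
theorem s_of_mF (m v : ℕ) (hv : v = 1 + p * m) : p * m = p * (v / p) := by
  rw [hv, Nat.add_mul_div_left _ _ hp.out.pos, Nat.div_eq_of_lt hp.out.one_lt, zero_add]

/-- **ONE MOVE OF B's TRAP**: whatever non-empty centre A names, B's answer leads from a position to a
position. [folklore] -/
theorem step_posSt (a e b : ℕ) (U E : MvPowerSeries (Fin 3) κ) (hU : IsUnit U) (hE : IsUnit E)
    (F : Finset (Fin 3)) (hF : F.Nonempty) :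
    ∃ (a' e' b' : ℕ) (U' E' : MvPowerSeries (Fin 3) κ), IsUnit U' ∧ IsUnit E' ∧
      step p F (chartR F) (tauR κ) (fn (posSt p a e b U E)) = fn (posSt p a' e' b' U' E') := by
  obtain ⟨hmU, hm02, hm01, hm12, hm0, hm1, hm2, -, -, -⟩ := orders_posSt p κ a e b U E hU hE
  obtain ⟨⟨hP, hPu, hPe⟩, ⟨hLy, hLyu, hLye⟩, ⟨hLz, hLzu, hLze⟩, ⟨hLx, hLxu, hLxe⟩, hD⟩ :=
    closure_posSt p κ a e b U E hU hE
  rcases finset_fin_three_cases F with rfl | rfl | rfl | rfl | rfl | rfl | rfl | rfl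
  · exact absurd hF Finset.not_nonempty_empty
  · -- {x}: division by x^{p·min a b}
    refine ⟨a - min a b, e, b - min a b, U, E, hU, hE, ?_⟩
    have hc : chartR {0} = 0 := by simp [chartR]
    rw [hc]
    refine step_eq_of_fac p κ {0} 0 (by simp) a e b _ _ _ U E U E hU hE hU hE (p * min a b)
      (s_of_mF p _ _ hm0) ?_
    rw [substMap_single, MvPowerSeries.subst_self]; exact hD
  · -- {y}: identity
    refine ⟨a, e, b, U, E, hU, hE, ?_⟩
    have hc : chartR {1} = 1 := by simp [chartR]
    rw [hc]
    refine step_eq_of_fac p κ {1} 1 (by simp) a e b _ _ _ U E U E hU hE hU hE 0 (by rw [hm1]; simp) ?_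
    rw [substMap_single, MvPowerSeries.subst_self, pow_zero, one_mul]; rfl
  · -- {z}: identity
    refine ⟨a, e, b, U, E, hU, hE, ?_⟩
    have hc : chartR {2} = 2 := by simp [chartR]
    rw [hc]
    refine step_eq_of_fac p κ {2} 2 (by simp) a e b _ _ _ U E U E hU hE hU hE 0 (by rw [hm2]; simp) ?_
    rw [substMap_single, MvPowerSeries.subst_self, pow_zero, one_mul]; rfl
  · -- {x,y}: chart x
    refine ⟨a + 2 - min (a + 2) b, e, b - min (a + 2) b, _, _, hLzu, hLze, ?_⟩
    have hc : chartR {0, 1} = 0 := by simp [chartR]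
    rw [hc]
    refine step_eq_of_fac p κ {0, 1} 0 (by simp) a e b _ _ _ U E _ _ hU hE hLzu hLze
      (p * min (a + 2) b) (s_of_mF p _ _ hm01) ?_
    exact hLz
  · -- {x,z}: chart x
    refine ⟨a + 2 * e - min (a + 2 * e) (b + 3), 0, b + 3 - min (a + 2 * e) (b + 3), _, _, hLyu, hLye, ?_⟩
    have hc : chartR {0, 2} = 0 := by simp [chartR]
    rw [hc]
    refine step_eq_of_fac p κ {0, 2} 0 (by simp) a e b _ _ _ U E _ _ hU hE hLyu hLye
      (p * min (a + 2 * e) (b + 3)) (s_of_mF p _ _ hm02) ?_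
    exact hLy
  · -- {y,z}: chart z
    refine ⟨a, e + 1, b, _, _, hLxu, hLxe, ?_⟩
    have hc : chartR {1, 2} = 2 := by simp [chartR]
    rw [hc]
    refine step_eq_of_fac p κ {1, 2} 2 (by simp) a e b _ _ _ U E _ _ hU hE hLxu hLxe 0
      (by rw [hm12]; simp) ?_
    rw [pow_zero, one_mul]; exact hLx
  · -- the point: chart x
    refine ⟨a + 2 * e + 2 - min (a + 2 * e + 2) (b + 3), 0, b + 3 - min (a + 2 * e + 2) (b + 3), _, _,
      hPu, hPe, ?_⟩
    have hc : chartR Finset.univ = 0 := by simp [chartR]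
    rw [hc]
    refine step_eq_of_fac p κ Finset.univ 0 (by simp) a e b _ _ _ U E _ _ hU hE hPu hPe
      (p * min (a + 2 * e + 2) (b + 3)) (s_of_mF p _ _ hmU) ?_
    exact hP

/-- `(1 − x)³` is a unit. [folklore] -/
theorem isUnit_one_sub_X_pow : IsUnit (((1 : MvPowerSeries (Fin 3) κ) - X 0) ^ 3) := by
  refine IsUnit.pow 3 ?_
  rw [MvPowerSeries.isUnit_iff_constantCoeff]; simp

/-- **B's simulated play never leaves the position family**, against EVERY strategy with non-empty
centres. [folklore] -/
theorem runR_fst_posSt (strat : List (Set (Fin 3 → ℚ)) → List (Fin 3) → Finset (Fin 3))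
    (hne : ∀ hs js, (strat hs js).Nonempty) :
    ∀ m, ∃ (a e b : ℕ) (U E : MvPowerSeries (Fin 3) κ), IsUnit U ∧ IsUnit E ∧
      (runR κ p strat m).1 = fn (posSt p a e b U E)
  | 0 => ⟨0, 0, 0, (1 - X 0) ^ 3, 1, isUnit_one_sub_X_pow κ, isUnit_one, rfl⟩
  | m + 1 => by
    obtain ⟨a, e, b, U, E, hU, hE, hrun⟩ := runR_fst_posSt strat hne m
    obtain ⟨a', e', b', U', E', hU', hE', hstep⟩ := step_posSt p κ a e b U E hU hE
      (strat (runR κ p strat m).2.1 (runR κ p strat m).2.2) (hne _ _)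
    refine ⟨a', e', b', U', E', hU', hE', ?_⟩
    show step p (strat (runR κ p strat m).2.1 (runR κ p strat m).2.2)
        (chartR (strat (runR κ p strat m).2.1 (runR κ p strat m).2.2)) (tauR κ) (runR κ p strat m).1 = _
    rw [hrun, hstep]

end Assembly

end Summit.ResolutionOfSingularities.ResolutionOfSingularities.Theorems.ShadowGameWinR.Negative

end
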